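import Literature.AlgebraicGeometry.ComplexMultiplication.CyclotomicFermatCMTypesFourFivePrimeLevelMaximum
import Literature.AlgebraicGeometry.ComplexMultiplication.CyclotomicFermatCMTypesThreePrimeLevelMaximumStrict
import Literature.AlgebraicGeometry.ComplexMultiplication.CyclotomicFermatCMTypesSixToNinePrimeLevelSimple
import HarnessLib

/-!
# Koblitz–Rohrlich, REMARK 1 "`3/20` is the maximum for `s(N)`" at EVERY level prime to `6`: the levels with at least six prime factors
# (`40·#S₀(N) < 3·φ(N)`), and the assembly `s(N) ≤ 3/20` with equality iff `N = 55`

Layer `Literature/AlgebraicGeometry/ComplexMultiplication`, namespace `…ComplexMultiplication.CyclotomicFermatCMType`; sequel of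
`CyclotomicFermatCMTypesTwoPrimeLevelMaximum` (`ω(N) ≤ 2`, `s(55) = 3/20`), `CyclotomicFermatCMTypesThreePrimeLevelMaximumStrict` (`ω(N) = 3`),
`CyclotomicFermatCMTypesFourFivePrimeLevelMaximum` (`ω(N) ∈ {4, 5}`, the weighted criterion) and `CyclotomicFermatCMTypesSixToNinePrimeLevelSimple`
(Table 1 extended: `5ᵈ − 1`, `d ≤ 13`; `7ᵈ − 1`, `d ≤ 9`).  THEOREMS ONLY (no definition, no named fact, no `sorry`).

THE SOURCE.  N. Koblitz, D. Rohrlich, *Simple factors in the Jacobian of a Fermat curve*, Canad. J. Math. **30** (1978) 1183–1205, §2: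
"PROPOSITION.  Suppose `2, 3 ∤ N`. Let `S(N)` be the set of odd characters of `(ℤ/Nℤ)^*`, and let `S₀(N) ⊂ S(N)` be the set of "bad" characters,
i.e., `S₀(N) = {χ ∈ S(N) | B_{1,χ} = 0}`.  Then `#S₀(N) < (1/6)#S(N)`" (p. 1190), proved through "`s(N) ≤ Σᵢ 1/((pᵢ − 1)ordᵢ)`" (p. 1190) and
the cases `m = 2, 3, 4`, "Case 4. `5 ≤ m ≤ 9`. From Table 1, if `pᵢ = 5, 7, 11`, then `ordᵢ ≥ 10, 10, 6`, respectively, and if `13 ≤ pᵢ ≤ 29`,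
then `ordᵢ ≥ 5`", "Case 5. `m ≥ 10`.  We show that for all `pᵢ` we have `(pᵢ − 1)ordᵢ > 6m` … (1) `pᵢ = 5`. `ordᵢ > log₅(7·11·13·17·19·23·29·31·37·
41^{m−10})` … (2) `pᵢ = 7` … (3) `pᵢ = 11` … (4) `13 ≤ pᵢ ≤ 3m/2 + 1` … (5) … (6) `pᵢ > 6m + 1`" (pp. 1191–1192); and REMARK 1 (p. 1192):
"When `N = 55`, `#S(N) = ½φ(N) = 20`, and `#S₀(N) = 3` … Thus, `s(55) = 3/20`.  It is clear from the above proof that `3/20` is the maximum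
for `s(N)`."

WHAT IS PROVED.  The siblings typed Remark 1 for `ω(N) ≤ 5` (`s(N) ≤ 3/20`, with equality iff `N = 55`).  Here: for `ω(N) = m ≥ 6` the
per-prime bound `20m < 3(ℓ − 1)·d` whenever the `m − 1` other prime factors of `N` divide `ℓᵈ − 1` (§3), whence `40·#S₀(N) < 3·φ(N)` by the
sibling's weighted criterion (§4), and the assembly at EVERY level `N > 1` prime to `6` (§5): `40·#S₀(N) ≤ 3·φ(N)`, `<` iff `N ≠ 55`;
`s(N) ≤ 3/20 = s(55)`, `s(N) = 3/20` iff `N = 55`.  A CAVEAT ON THE PRINTED NUMBERS (as in the siblings, said once, here): K–R's Case 4 bounds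
(`1/40, 1/60, 1/60, 1/60, 1/60`) sum to `1/40 + (m − 1)/60 < 3/20` only for `m ≤ 8`, and Case 5's "`> 6m`" gives `1/6`, not `3/20`; Remark 1's
"clear from the above proof" therefore needs sharper per-prime words at `m ≥ 9`, which we supply: `ℓ = 5`: Table 1 carried to `d = 15`
(`5¹⁴ − 1 = 2³·3·29·449·19531`, `5¹⁵ − 1 = 2²·11·31·71·181·1741`, machine-checked) and K–R's own Case 5 (1) product for `m ≥ 10` (`d ≥ 2m − 3`);
`ℓ = 7`: the row `7¹⁰ − 1 = 2⁴·3·11·191·2801` and Case 5 (2)'s product, squared (`7²⁴ ≤ (11·13·…·37)²`, `7³ ≤ 41²`); `ℓ = 11`: the rows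
`11ᵈ − 1`, `d ≤ 4`, and `d ≥ t + 1` ("`ordᵢ > log_{pᵢ} Nᵢ ≥ m − i`"); `ℓ ≥ 13`: K–R's (4)–(6) with the size bound `5ˢ·ℓᵗ < ℓᵈ` (`s` primes of
`N` below `ℓ`, `t` above).

* §1 numerics (private): `20(s + 1) < 3·5ˢ` (`s ≥ 2`), `(10s + 13)² ≤ 9·5ˢ` (`s ≥ 4`), the layer bound and K–R's constants `7·…·37`, `11·…·37`.
* §2 Table 1, further rows: `card_le_six_of_forall_dvd_five_pow_sub_one` (`5ᵈ − 1`, `d ≤ 15`: at most six primes `≥ 5`),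
  `card_le_four_of_forall_dvd_pow_sub_one'` (`7ᵈ − 1`, `d ≤ 10`; `11ᵈ − 1`, `d ≤ 4`: at most four).
* §3 **`twenty_mul_card_succ_lt_of_five_le_card`** — `ℓ` prime `≥ 5`, `d ≥ 1`, `Q` a set of `≥ 5` primes `≥ 5` dividing `ℓᵈ − 1` ⟹
  `20(#Q + 1) < 3(ℓ − 1)·d`.
* §4 `forty_mul_sum_card_lt_of_forall_lt` (the weighted criterion with the hypothesis `20ω(N) < 3(ℓ − 1)d`);
  **`forty_mul_card_bad_lt_of_six_le_card_primeFactors`** (`ω(N) ≥ 6` ⟹ `40·#S₀(N) < 3·φ(N)`), `s_lt_three_div_twenty_of_six_le_card_primeFactors`.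
* §5 EVERY LEVEL `N > 1` prime to `6`: **`forty_mul_card_bad_le_of_five_le_primeFactors`**, **`forty_mul_card_bad_lt_iff_ne_fiftyFive`**,
  `twenty_mul_card_bad_le_three_mul_card_odd` (the printed normalisation `#S₀(N) ≤ (3/20)#S(N)`), **`s_le_three_div_twenty`**,
  **`s_eq_three_div_twenty_iff`**, `s_lt_three_div_twenty_iff`, **`s_le_s_fiftyFive`** ("`3/20` is the maximum for `s(N)`", attained at `55` only).

## Honest column / NOT here

* The per-prime constants and the three extra Table rows are ours (K–R print bounds aimed at `1/6`); "`lim s(N) = 0`" is NOT typed.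
* Private copies: the layer bound `prod_mul_pow_le_prod`, the primes `< 41`, the constants `247357937827`, `35336848261` (sibling
  `CyclotomicFermatCMTypesCoprimeSixLevelSimple`), the `2ⁱ3ʲ∏sₙ^{aₙ}` divisor lemmas, `s < 3/20` from `40·# < 3φ`.

## References

* [KoblitzRohrlich1978] N. Koblitz, D. Rohrlich, Canad. J. Math. 30 (1978) 1183–1205: §2 Proposition, Table 1, Cases 1–5 (pp. 1190–1192),
  Remark 1 (p. 1192).

## Provenance

Cell `pub-hodgecm2` (COR-CM), literature seat `lit-deligne-3` gen 36 (claim KR78-MAXIMUM-ALL; count-neutral, own lane).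
-/

noncomputable section

open NumberField

namespace Literature.AlgebraicGeometry.ComplexMultiplication

open Literature.NumberTheory.ComplexMultiplication
open Literature.NumberTheory.LFunctions

namespace CyclotomicFermatCMType

/-! ## §1 Numerics: two growth lemmas, the layer bound, K–R's constants -/

section Numerics

/-- `20(s + 1) < 3·5ˢ` for `s ≥ 2`. [folklore] -/
private theorem twenty_mul_succ_lt_three_mul_five_pow {s : ℕ} (hs : 2 ≤ s) : 20 * (s + 1) < 3 * 5 ^ s := by
  induction s, hs using Nat.le_induction with
  | base => norm_num
  | succ s hs ih =>
    have h5 : 1 ≤ 5 ^ s := Nat.one_le_pow _ _ (by norm_num)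
    rw [pow_succ]
    omega

/-- `(10s + 13)² ≤ 9·5ˢ` for `s ≥ 4`. [folklore] -/
private theorem sq_le_nine_mul_five_pow {s : ℕ} (hs : 4 ≤ s) : (10 * s + 13) ^ 2 ≤ 9 * 5 ^ s := by
  induction s, hs using Nat.le_induction with
  | base => norm_num
  | succ s hs ih =>
    have h1 : (10 * (s + 1) + 13) ^ 2 ≤ 5 * (10 * s + 13) ^ 2 := by nlinarith
    calc (10 * (s + 1) + 13) ^ 2 ≤ 5 * (10 * s + 13) ^ 2 := h1
      _ ≤ 5 * (9 * 5 ^ s) := Nat.mul_le_mul_left _ ih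
      _ = 9 * 5 ^ (s + 1) := by ring

/-- **Layer bound** (private copy of the sibling's): if the elements of `Q` below `B` all lie in `T`, the elements of `T` are `≤ B`, and
`#T ≤ #Q`, then `∏ T · B^{#Q − #T} ≤ ∏ Q`. [folklore] -/
private theorem prod_mul_pow_le_prod' {Q T : Finset ℕ} {B : ℕ} (hT : ∀ q ∈ T, q ≤ B) (hQ : ∀ q ∈ Q, q < B → q ∈ T)
    (hcard : T.card ≤ Q.card) : (∏ q ∈ T, q) * B ^ (Q.card - T.card) ≤ ∏ q ∈ Q, q := by
  classical
  set Q' := Q.filter (· < B) with hQ'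
  set Q'' := Q.filter (fun q => ¬q < B) with hQ''
  have hsub : Q' ⊆ T := fun q hq => by
    rw [hQ', Finset.mem_filter] at hq
    exact hQ q hq.1 hq.2
  have h1 : B ^ Q''.card ≤ ∏ q ∈ Q'', q :=
    Finset.pow_card_le_prod Q'' (fun q => q) B fun q hq => by
      rw [hQ'', Finset.mem_filter] at hq
      exact not_lt.1 hq.2
  have h2 : ∏ q ∈ T, q ≤ (∏ q ∈ Q', q) * B ^ (T.card - Q'.card) := by
    rw [← Finset.prod_sdiff hsub, mul_comm, ← Finset.card_sdiff_of_subset hsub]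
    exact Nat.mul_le_mul_left _ (Finset.prod_le_pow_card (T \ Q') (fun q => q) B fun q hq => hT q (Finset.mem_sdiff.1 hq).1)
  have hcQ : Q'.card + Q''.card = Q.card := Finset.card_filter_add_card_filter_not (· < B)
  have hQ'T : Q'.card ≤ T.card := Finset.card_le_card hsub
  calc (∏ q ∈ T, q) * B ^ (Q.card - T.card) ≤ (∏ q ∈ Q', q) * B ^ (T.card - Q'.card) * B ^ (Q.card - T.card) :=
        Nat.mul_le_mul_right _ h2
    _ = (∏ q ∈ Q', q) * B ^ Q''.card := by
        rw [mul_assoc, ← pow_add]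
        congr 2
        omega
    _ ≤ (∏ q ∈ Q', q) * ∏ q ∈ Q'', q := Nat.mul_le_mul_left _ h1
    _ = ∏ q ∈ Q, q := Finset.prod_filter_mul_prod_filter_not Q (· < B) fun q => q

/-- The primes `q` with `5 < q < 41` (private copy). [folklore] -/
private theorem mem_of_prime_lt_41' {q : ℕ} (hq : q.Prime) (h5 : 5 < q) (h41 : q < 41) :
    q ∈ ({7, 11, 13, 17, 19, 23, 29, 31, 37} : Finset ℕ) := by
  interval_cases q <;> first | exact absurd hq (by decide) | simp

/-- `7·11·13·17·19·23·29·31·37 = 247357937827` (K–R's constant of Case 5 (1); private copy). [cite: KoblitzRohrlich1978, §2 Case 5 (1) (p. 1192)] -/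
private theorem prod_primes_7_to_37' : (∏ q ∈ ({7, 11, 13, 17, 19, 23, 29, 31, 37} : Finset ℕ), q) = 247357937827 := by
  decide

/-- `11·13·17·19·23·29·31·37 = 35336848261` (private copy). [folklore] -/
private theorem prod_primes_11_to_37' : (∏ q ∈ ({11, 13, 17, 19, 23, 29, 31, 37} : Finset ℕ), q) = 35336848261 := by
  decide

end Numerics

/-! ## §2 Table 1, further rows: `5¹⁴ − 1`, `5¹⁵ − 1`, `7¹⁰ − 1`, `11ᵈ − 1` (`d ≤ 4`) -/

section TableOne

/-- A prime `≥ 5` does not divide `2ⁱ·3ʲ` (private copy). [folklore] -/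
private theorem not_dvd_two_pow_mul_three_pow₆ {q : ℕ} (hq : q.Prime) (h5 : 5 ≤ q) (i j : ℕ) : ¬q ∣ 2 ^ i * 3 ^ j := by
  intro h
  rcases (Nat.Prime.dvd_mul hq).1 h with h2 | h3
  · have := (Nat.prime_dvd_prime_iff_eq hq Nat.prime_two).1 (hq.dvd_of_dvd_pow h2)
    omega
  · have := (Nat.prime_dvd_prime_iff_eq hq Nat.prime_three).1 (hq.dvd_of_dvd_pow h3)
    omega

/-- A prime `q ≥ 5` dividing `2ⁱ·3ʲ·sᵃ·tᵇ·uᶜ·vᵉ` (`s, t, u, v` prime) is one of `s, t, u, v` (private copy). [folklore] -/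
private theorem mem_of_dvd₄ {q s t u v i j a b c e : ℕ} (hq : q.Prime) (h5 : 5 ≤ q) (hs : s.Prime) (ht : t.Prime)
    (hu : u.Prime) (hv : v.Prime) (h : q ∣ 2 ^ i * 3 ^ j * s ^ a * t ^ b * u ^ c * v ^ e) :
    q ∈ ({s, t, u, v} : Finset ℕ) := by
  simp only [Finset.mem_insert, Finset.mem_singleton]
  rcases (Nat.Prime.dvd_mul hq).1 h with h₁ | h₁
  · rcases (Nat.Prime.dvd_mul hq).1 h₁ with h₂ | h₂
    · rcases (Nat.Prime.dvd_mul hq).1 h₂ with h₃ | h₃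
      · rcases (Nat.Prime.dvd_mul hq).1 h₃ with h₄ | h₄
        · exact absurd h₄ (not_dvd_two_pow_mul_three_pow₆ hq h5 i j)
        · exact Or.inl ((Nat.prime_dvd_prime_iff_eq hq hs).1 (hq.dvd_of_dvd_pow h₄))
      · exact Or.inr (Or.inl ((Nat.prime_dvd_prime_iff_eq hq ht).1 (hq.dvd_of_dvd_pow h₃)))
    · exact Or.inr (Or.inr (Or.inl ((Nat.prime_dvd_prime_iff_eq hq hu).1 (hq.dvd_of_dvd_pow h₂))))
  · exact Or.inr (Or.inr (Or.inr ((Nat.prime_dvd_prime_iff_eq hq hv).1 (hq.dvd_of_dvd_pow h₁))))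

/-- If every element of a finset `Q` of primes `≥ 5` divides `X = 2ⁱ·3ʲ·sᵃ·tᵇ·uᶜ·vᵉ` (`s, t, u, v` prime), then `#Q ≤ 4` (private copy). [folklore] -/
private theorem card_le_four_of_forall_dvd' {Q : Finset ℕ} {X s t u v i j a b c e : ℕ}
    (hX : X = 2 ^ i * 3 ^ j * s ^ a * t ^ b * u ^ c * v ^ e) (hs : s.Prime) (ht : t.Prime) (hu : u.Prime) (hv : v.Prime)
    (hQ : ∀ q ∈ Q, q.Prime ∧ 5 ≤ q ∧ q ∣ X) : Q.card ≤ 4 := by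
  subst hX
  calc Q.card ≤ ({s, t, u, v} : Finset ℕ).card :=
        Finset.card_le_card fun q hq => mem_of_dvd₄ (hQ q hq).1 (hQ q hq).2.1 hs ht hu hv (hQ q hq).2.2
    _ ≤ 4 := Finset.card_le_four

/-- A prime `q ≥ 5` dividing `2ⁱ·3ʲ·sᵃ·tᵇ·uᶜ·vᵉ·wᶠ·xᵍ` (`s, t, u, v, w, x` prime) is one of them. [folklore] -/
private theorem mem_of_dvd₆ {q s t u v w x i j a b c e f g : ℕ} (hq : q.Prime) (h5 : 5 ≤ q) (hs : s.Prime) (ht : t.Prime)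
    (hu : u.Prime) (hv : v.Prime) (hw : w.Prime) (hx : x.Prime)
    (h : q ∣ 2 ^ i * 3 ^ j * s ^ a * t ^ b * u ^ c * v ^ e * w ^ f * x ^ g) :
    q ∈ ({s, t, u, v, w, x} : Finset ℕ) := by
  simp only [Finset.mem_insert, Finset.mem_singleton]
  rcases (Nat.Prime.dvd_mul hq).1 h with k₁ | k₁
  · rcases (Nat.Prime.dvd_mul hq).1 k₁ with k₂ | k₂
    · have hm := mem_of_dvd₄ (i := i) (j := j) (a := a) (b := b) (c := c) (e := e) hq h5 hs ht hu hv k₂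
      simp only [Finset.mem_insert, Finset.mem_singleton] at hm
      rcases hm with hm | hm | hm | hm
      · exact Or.inl hm
      · exact Or.inr (Or.inl hm)
      · exact Or.inr (Or.inr (Or.inl hm))
      · exact Or.inr (Or.inr (Or.inr (Or.inl hm)))
    · exact Or.inr (Or.inr (Or.inr (Or.inr (Or.inl ((Nat.prime_dvd_prime_iff_eq hq hw).1 (hq.dvd_of_dvd_pow k₂))))))
  · exact Or.inr (Or.inr (Or.inr (Or.inr (Or.inr ((Nat.prime_dvd_prime_iff_eq hq hx).1 (hq.dvd_of_dvd_pow k₁))))))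

/-- If every element of a finset `Q` of primes `≥ 5` divides `X = 2ⁱ·3ʲ·sᵃ·tᵇ·uᶜ·vᵉ·wᶠ·xᵍ` (six prime slots), then `#Q ≤ 6`. [folklore] -/
private theorem card_le_six_of_forall_dvd {Q : Finset ℕ} {X s t u v w x i j a b c e f g : ℕ}
    (hX : X = 2 ^ i * 3 ^ j * s ^ a * t ^ b * u ^ c * v ^ e * w ^ f * x ^ g) (hs : s.Prime) (ht : t.Prime) (hu : u.Prime)
    (hv : v.Prime) (hw : w.Prime) (hx : x.Prime) (hQ : ∀ q ∈ Q, q.Prime ∧ 5 ≤ q ∧ q ∣ X) : Q.card ≤ 6 := by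
  subst hX
  calc Q.card ≤ ({s, t, u, v, w, x} : Finset ℕ).card :=
        Finset.card_le_card fun q hq => mem_of_dvd₆ (hQ q hq).1 (hQ q hq).2.1 hs ht hu hv hw hx (hQ q hq).2.2
    _ ≤ 6 := Finset.card_le_six

/-- **TABLE 1, the column `p = 5` carried to `d = 15`**: for `d ≤ 15`, at most six distinct primes `≥ 5` divide `5ᵈ − 1` (`d ≤ 13`: at most
four, the sibling's `card_le_four_of_forall_dvd_pow_sub_one`; the two further rows, NOT printed by K–R and machine-checked here, are
`5¹⁴ − 1 = 2³·3·29·449·19531` and `5¹⁵ − 1 = 2²·11·31·71·181·1741`, with `449, 1741, 19531` prime). [cite: KoblitzRohrlich1978, §2 Table 1 (p. 1190)] -/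
theorem card_le_six_of_forall_dvd_five_pow_sub_one {d : ℕ} (hd15 : d ≤ 15) (hd : 0 < d) {Q : Finset ℕ}
    (hQ : ∀ q ∈ Q, q.Prime ∧ 5 ≤ q ∧ q ∣ 5 ^ d - 1) : Q.card ≤ 6 := by
  rcases Nat.lt_or_ge d 14 with h13 | h14
  · exact (card_le_four_of_forall_dvd_pow_sub_one (Or.inl ⟨rfl, by omega⟩) hd hQ).trans (by norm_num)
  · have hd' : d = 14 ∨ d = 15 := by omega
    rcases hd' with rfl | rfl
    · exact card_le_six_of_forall_dvd (X := 5 ^ 14 - 1) (i := 3) (j := 1) (s := 29) (a := 1) (t := 449) (b := 1) (u := 19531)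
        (c := 1) (v := 5) (e := 0) (w := 5) (f := 0) (x := 5) (g := 0) (by norm_num) (by norm_num) (by norm_num) (by norm_num)
        (by norm_num) (by norm_num) (by norm_num) hQ
    · exact card_le_six_of_forall_dvd (X := 5 ^ 15 - 1) (i := 2) (j := 0) (s := 11) (a := 1) (t := 31) (b := 1) (u := 71)
        (c := 1) (v := 181) (e := 1) (w := 1741) (f := 1) (x := 5) (g := 0) (by norm_num) (by norm_num) (by norm_num) (by norm_num)
        (by norm_num) (by norm_num) (by norm_num) hQ

/-- **TABLE 1, the column `p = 7` carried to `d = 10`, and the column `p = 11` through `d = 4`**: at most four distinct primes `≥ 5` divide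
`7ᵈ − 1` for `d ≤ 10` (`d ≤ 9`: the sibling's; `7¹⁰ − 1 = 2⁴·3·11·191·2801`, NOT printed, machine-checked) and `11ᵈ − 1` for `d ≤ 4` (printed
rows: `5; 5; 5, 7, 19; 5, 61` — `11 − 1 = 2·5`, `11² − 1 = 2³·3·5`, `11³ − 1 = 2·5·7·19`, `11⁴ − 1 = 2⁴·3·5·61`).
[cite: KoblitzRohrlich1978, §2 Table 1 (p. 1190)] -/
theorem card_le_four_of_forall_dvd_pow_sub_one' {ℓ d : ℕ} (hℓ : (ℓ = 7 ∧ d ≤ 10) ∨ (ℓ = 11 ∧ d ≤ 4)) (hd : 0 < d) {Q : Finset ℕ}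
    (hQ : ∀ q ∈ Q, q.Prime ∧ 5 ≤ q ∧ q ∣ ℓ ^ d - 1) : Q.card ≤ 4 := by
  have key : ∀ {i j s a t b u c v e : ℕ}, s.Prime → t.Prime → u.Prime → v.Prime →
      ℓ ^ d - 1 = 2 ^ i * 3 ^ j * s ^ a * t ^ b * u ^ c * v ^ e → Q.card ≤ 4 :=
    fun hs ht hu hv he => card_le_four_of_forall_dvd' he hs ht hu hv hQ
  rcases hℓ with ⟨rfl, hd10⟩ | ⟨rfl, hd4⟩
  · rcases Nat.lt_or_ge d 10 with h9 | h10
    · exact card_le_four_of_forall_dvd_pow_sub_one (Or.inr ⟨rfl, by omega⟩) hd hQ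
    · have hd' : d = 10 := by omega
      subst hd'
      exact key (i := 4) (j := 1) (s := 11) (a := 1) (t := 191) (b := 1) (u := 2801) (c := 1) (v := 5) (e := 0)
        (by norm_num) (by norm_num) (by norm_num) (by norm_num) (by norm_num)
  · have hd' : d = 1 ∨ d = 2 ∨ d = 3 ∨ d = 4 := by omega
    rcases hd' with rfl | rfl | rfl | rfl
    · exact key (i := 1) (j := 0) (s := 5) (a := 1) (t := 5) (b := 0) (u := 5) (c := 0) (v := 5) (e := 0)
        (by norm_num) (by norm_num) (by norm_num) (by norm_num) (by norm_num)
    · exact key (i := 3) (j := 1) (s := 5) (a := 1) (t := 5) (b := 0) (u := 5) (c := 0) (v := 5) (e := 0)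
        (by norm_num) (by norm_num) (by norm_num) (by norm_num) (by norm_num)
    · exact key (i := 1) (j := 0) (s := 5) (a := 1) (t := 7) (b := 1) (u := 19) (c := 1) (v := 5) (e := 0)
        (by norm_num) (by norm_num) (by norm_num) (by norm_num) (by norm_num)
    · exact key (i := 4) (j := 1) (s := 5) (a := 1) (t := 61) (b := 1) (u := 5) (c := 0) (v := 5) (e := 0)
        (by norm_num) (by norm_num) (by norm_num) (by norm_num) (by norm_num)

end TableOne

/-! ## §3 The per-prime bound `20m < 3(ℓ − 1)·d` when `m − 1 ≥ 5` distinct primes `≥ 5` divide `ℓᵈ − 1` -/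

section PerPrime

/-- **`20m < 3(ℓ − 1)·ord` for `m ≥ 6`** — the per-prime input of Remark 1 ("`3/20` is the maximum for `s(N)`") at levels with at least six
prime factors, in the uniform shape of the sibling's weighted criterion: if `ℓ` is a prime `≥ 5`, `d ≥ 1`, and `Q` is a set of at least five
primes `≥ 5` each dividing `ℓᵈ − 1`, then `20(#Q + 1) < 3(ℓ − 1)·d`.  Following K–R's proof of the Proposition (Cases 4–5, pp. 1191–1192) with
sharper words: `ℓ = 5` ("(1)"): `d ≥ 14` (Table 1 through `d = 13`), `d ≥ 16` when `#Q ≥ 7` (the rows `d = 14, 15` of §2), and for `#Q ≥ 9`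
`5^{2#Q − 2} ≤ 7·11·…·37·41^{#Q − 9} ≤ ∏ Q < 5ᵈ`; `ℓ = 7` ("(2)"): `d ≥ 11` (Table 1 through `d = 10`), and for `#Q ≥ 9`
`7^{24 + 3(t − 8)} ≤ (11·13·…·37·41^{t−8})² ≤ (∏ Q)² < 7^{2d}` (`t ≥ #Q − 1` primes of `Q` above `7`); `ℓ = 11` ("(3)"): `d ≥ 5` (Table 1) and
`d ≥ t + 1 ≥ #Q − 1` ("`ordᵢ > log_{pᵢ} Nᵢ ≥ m − i`"); `ℓ ≥ 13` ("(4)–(6)"): with `s` primes of `Q` below `ℓ` and `t` above, `3s + 2 ≤ ℓ`,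
`d = t + e` with `e ≥ 1` and `5ˢ < ℓᵉ` (from `5ˢ·ℓᵗ ≤ ∏ Q < ℓᵈ`), and a case analysis in `e ∈ {1, 2}, e ≥ 3`.
[cite: KoblitzRohrlich1978, §2 Proposition, Cases 4–5 (pp. 1191–1192), Table 1 (p. 1190) and Remark 1 (p. 1192)] -/
theorem twenty_mul_card_succ_lt_of_five_le_card {ℓ d : ℕ} (hℓ : ℓ.Prime) (hℓ5 : 5 ≤ ℓ) (hd : 0 < d) {Q : Finset ℕ}
    (hQ : ∀ q ∈ Q, q.Prime ∧ 5 ≤ q ∧ q ∣ ℓ ^ d - 1) (h5 : 5 ≤ Q.card) : 20 * (Q.card + 1) < 3 * ((ℓ - 1) * d) := by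
  classical
  -- `∏ Q ∣ ℓᵈ − 1`, so `∏ Q < ℓᵈ`; no element of `Q` is `ℓ`
  have h1d : 1 ≤ ℓ ^ d := Nat.one_le_pow _ _ hℓ.pos
  have hpos : 0 < ℓ ^ d - 1 := by
    have : ℓ ^ 1 ≤ ℓ ^ d := Nat.pow_le_pow_right hℓ.pos hd
    rw [pow_one] at this
    omega
  have hprod : ∏ q ∈ Q, q ∣ ℓ ^ d - 1 :=
    Finset.prod_primes_dvd _ (fun q hq => Nat.prime_iff.1 (hQ q hq).1) fun q hq => (hQ q hq).2.2
  have hlt : ∏ q ∈ Q, q < ℓ ^ d := lt_of_le_of_lt (Nat.le_of_dvd hpos hprod) (by omega)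
  have hne : ∀ q ∈ Q, q ≠ ℓ := by
    intro q hq hql
    have hdvd : ℓ ∣ ℓ ^ d - 1 := hql ▸ (hQ q hq).2.2
    have h1 : ℓ ∣ ℓ ^ d - 1 + 1 := by
      rw [Nat.sub_add_cancel h1d]
      exact dvd_pow_self ℓ hd.ne'
    exact hℓ.one_lt.ne' (Nat.dvd_one.1 ((Nat.dvd_add_right hdvd).1 h1))
  -- the primes of `Q` above `ℓ`: `t` of them, and `d ≥ t + 1`
  set t := (Q.filter (ℓ < ·)).card with ht
  have hsubU : Q.filter (ℓ < ·) ⊆ Q := Finset.filter_subset _ _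
  have hprodU : ∏ q ∈ Q.filter (ℓ < ·), q ≤ ∏ q ∈ Q, q :=
    Finset.prod_le_prod_of_subset_of_one_le' hsubU fun q hq _ => (hQ q hq).1.one_lt.le
  have hpowU : (ℓ + 1) ^ t ≤ ∏ q ∈ Q.filter (ℓ < ·), q :=
    Finset.pow_card_le_prod _ (fun q => q) _ fun q hq => (Finset.mem_filter.1 hq).2
  have htd : t < d := by
    have h3 : ℓ ^ t < ℓ ^ d := lt_of_le_of_lt ((Nat.pow_le_pow_left (Nat.le_succ ℓ) t).trans (hpowU.trans hprodU)) hlt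
    exact (Nat.pow_lt_pow_iff_right hℓ.one_lt).1 h3
  -- the primes of `Q` below `ℓ`: `s` of them
  set s := (Q.filter fun q => ¬ℓ < q).card with hs
  have hst : t + s = Q.card := Finset.card_filter_add_card_filter_not (ℓ < ·)
  have hmemL : ∀ q ∈ Q.filter (fun q => ¬ℓ < q), q.Prime ∧ 5 ≤ q ∧ q < ℓ := fun q hq => by
    obtain ⟨hqQ, hqℓ⟩ := Finset.mem_filter.1 hq
    exact ⟨(hQ q hqQ).1, (hQ q hqQ).2.1, lt_of_le_of_ne (not_lt.1 hqℓ) (hne q hqQ)⟩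
  by_cases h13 : 13 ≤ ℓ
  · -- `3s + 2 ≤ ℓ`: `q ↦ q / 3` injects the primes `5 ≤ q < ℓ` of `Q` into `[1, (ℓ − 2)/3]`
    have hℓ2 : ¬2 ∣ ℓ := fun h => by rcases hℓ.eq_one_or_self_of_dvd 2 h with h | h <;> omega
    have h3s : 3 * s + 2 ≤ ℓ := by
      have hmaps : Set.MapsTo (fun q => q / 3) ↑(Q.filter fun q => ¬ℓ < q) ↑(Finset.Icc 1 ((ℓ - 2) / 3)) := by
        intro q hq
        obtain ⟨hqp, hq5, hqℓ⟩ := hmemL q hq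
        have hq2 : ¬2 ∣ q := fun h => by rcases hqp.eq_one_or_self_of_dvd 2 h with h | h <;> omega
        dsimp only
        rw [Finset.coe_Icc, Set.mem_Icc]
        constructor <;> omega
      have hinj : Set.InjOn (fun q => q / 3) ↑(Q.filter fun q => ¬ℓ < q) := by
        intro q hq q' hq' h
        obtain ⟨hqp, hq5, -⟩ := hmemL q hq
        obtain ⟨hqp', hq5', -⟩ := hmemL q' hq'
        have hq2 : ¬2 ∣ q := fun h => by rcases hqp.eq_one_or_self_of_dvd 2 h with h | h <;> omega
        have hq3 : ¬3 ∣ q := fun h => by rcases hqp.eq_one_or_self_of_dvd 3 h with h | h <;> omega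
        have hq2' : ¬2 ∣ q' := fun h => by rcases hqp'.eq_one_or_self_of_dvd 2 h with h | h <;> omega
        have hq3' : ¬3 ∣ q' := fun h => by rcases hqp'.eq_one_or_self_of_dvd 3 h with h | h <;> omega
        dsimp only at h
        omega
      have := Finset.card_le_card_of_injOn (fun q => q / 3) hmaps hinj
      rw [Nat.card_Icc] at this
      omega
    -- the size bound `5ˢ·ℓᵗ ≤ ∏ Q < ℓᵈ`, i.e. `5ˢ < ℓᵉ` with `d = t + e`
    have hsize : 5 ^ s * ℓ ^ t < ℓ ^ d := by
      have hL : 5 ^ s ≤ ∏ q ∈ Q.filter (fun q => ¬ℓ < q), q :=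
        Finset.pow_card_le_prod _ (fun q => q) 5 fun q hq => (hmemL q hq).2.1
      have hU : ℓ ^ t ≤ ∏ q ∈ Q.filter (ℓ < ·), q := (Nat.pow_le_pow_left (Nat.le_succ ℓ) t).trans hpowU
      have heq : (∏ q ∈ Q.filter (ℓ < ·), q) * ∏ q ∈ Q.filter (fun q => ¬ℓ < q), q = ∏ q ∈ Q, q :=
        Finset.prod_filter_mul_prod_filter_not Q (ℓ < ·) fun q => q
      calc 5 ^ s * ℓ ^ t ≤ (∏ q ∈ Q.filter (fun q => ¬ℓ < q), q) * ∏ q ∈ Q.filter (ℓ < ·), q := Nat.mul_le_mul hL hU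
        _ = ∏ q ∈ Q, q := by rw [mul_comm, heq]
        _ < ℓ ^ d := hlt
    obtain ⟨e, hde⟩ : ∃ e, d = t + e := ⟨d - t, by omega⟩
    have he5 : 5 ^ s < ℓ ^ e := by
      have h' : ℓ ^ t * 5 ^ s < ℓ ^ t * ℓ ^ e := by
        calc ℓ ^ t * 5 ^ s = 5 ^ s * ℓ ^ t := mul_comm _ _
          _ < ℓ ^ d := hsize
          _ = ℓ ^ t * ℓ ^ e := by rw [hde, pow_add]
      exact Nat.lt_of_mul_lt_mul_left h'
    have hXd : (ℓ - 1) * d = (ℓ - 1) * t + (ℓ - 1) * e := by rw [hde, mul_add]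
    have hXt : 12 * t ≤ (ℓ - 1) * t := Nat.mul_le_mul_right _ (by omega)
    have he1 : 1 ≤ e := by omega
    rcases Nat.lt_or_ge e 3 with he3 | he3
    · have he12 : e = 1 ∨ e = 2 := by omega
      rcases he12 with rfl | rfl
      · -- `e = 1`: `ℓ > 5ˢ`
        rw [pow_one] at he5
        have hXe : (ℓ - 1) * 1 = ℓ - 1 := mul_one _
        rcases Nat.lt_or_ge s 2 with hs2 | hs2
        · omega
        · have := twenty_mul_succ_lt_three_mul_five_pow hs2
          omega
      · -- `e = 2`: `ℓ² > 5ˢ`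
        have hXe : (ℓ - 1) * 2 = 2 * (ℓ - 1) := mul_comm _ _
        rcases Nat.lt_or_ge s 4 with hs4 | hs4
        · omega
        · have h9 : (10 * s + 13) ^ 2 < (3 * ℓ) ^ 2 := by
            calc (10 * s + 13) ^ 2 ≤ 9 * 5 ^ s := sq_le_nine_mul_five_pow hs4
              _ < 9 * ℓ ^ 2 := Nat.mul_lt_mul_of_pos_left he5 (by norm_num)
              _ = (3 * ℓ) ^ 2 := by ring
          have h3ℓ : 10 * s + 13 < 3 * ℓ := lt_of_pow_lt_pow_left₀ 2 (Nat.zero_le _) h9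
          omega
    · -- `e ≥ 3`
      have hXe : (ℓ - 1) * 3 ≤ (ℓ - 1) * e := Nat.mul_le_mul_left _ he3
      omega
  · -- `ℓ ∈ {5, 7, 11}`
    have hℓ' : ℓ = 5 ∨ ℓ = 7 ∨ ℓ = 11 := by
      interval_cases ℓ
      · exact Or.inl rfl
      · exact absurd hℓ (by decide)
      · exact Or.inr (Or.inl rfl)
      · exact absurd hℓ (by decide)
      · exact absurd hℓ (by decide)
      · exact absurd hℓ (by decide)
      · exact Or.inr (Or.inr rfl)
      · exact absurd hℓ (by decide)
    rcases hℓ' with rfl | rfl | rfl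
    · -- `ℓ = 5`: every element of `Q` is a prime `> 5`
      by_cases hk9 : 9 ≤ Q.card
      · -- layer bound with the primes below `41`: `5^{2#Q − 2} ≤ 247357937827·41^{#Q − 9} ≤ ∏ Q < 5ᵈ`
        have hlayer := prod_mul_pow_le_prod' (Q := Q) (T := {7, 11, 13, 17, 19, 23, 29, 31, 37}) (B := 41)
          (fun q hq => by simp only [Finset.mem_insert, Finset.mem_singleton] at hq; omega)
          (fun q hq hq41 => mem_of_prime_lt_41' (hQ q hq).1 (lt_of_le_of_ne (hQ q hq).2.1 (hne q hq).symm) hq41)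
          (by rw [show ({7, 11, 13, 17, 19, 23, 29, 31, 37} : Finset ℕ).card = 9 by simp]; omega)
        rw [prod_primes_7_to_37', show ({7, 11, 13, 17, 19, 23, 29, 31, 37} : Finset ℕ).card = 9 by simp] at hlayer
        have hpow : 5 ^ (2 * Q.card - 2) ≤ 247357937827 * 41 ^ (Q.card - 9) := by
          rw [show 2 * Q.card - 2 = 16 + 2 * (Q.card - 9) by omega, pow_add, pow_mul]
          exact Nat.mul_le_mul (by norm_num) (Nat.pow_le_pow_left (by norm_num) _)
        have := (Nat.pow_lt_pow_iff_right (by norm_num : 1 < 5)).1 (lt_of_le_of_lt (hpow.trans hlayer) hlt)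
        omega
      · -- Table 1: `d ≥ 14`, and `d ≥ 16` when `#Q ≥ 7`
        have hd14 : 14 ≤ d := by
          by_contra hlt'
          have := card_le_four_of_forall_dvd_pow_sub_one (Or.inl ⟨rfl, by omega⟩) hd hQ
          omega
        by_cases hk7 : 7 ≤ Q.card
        · have hd16 : 16 ≤ d := by
            by_contra hlt'
            have := card_le_six_of_forall_dvd_five_pow_sub_one (by omega) hd hQ
            omega
          omega
        · omega
    · -- `ℓ = 7`: at most one element (`5`) lies below `7`
      have hs1 : s ≤ 1 := by
        have : (Q.filter fun q => ¬7 < q) ⊆ {5} := fun q hq => by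
          obtain ⟨hqp, hq5, hq7⟩ := hmemL q hq
          rw [Finset.mem_singleton]
          interval_cases q
          · rfl
          · exact absurd hqp (by decide)
        exact (Finset.card_le_card this).trans (by simp)
      by_cases hk9 : 9 ≤ Q.card
      · -- `t ≥ 8`: layer bound above `7`, squared: `7^{24 + 3(t − 8)} ≤ (35336848261·41^{t−8})² ≤ (∏ Q)² < 7^{2d}`
        have hlayer := prod_mul_pow_le_prod' (Q := Q.filter (7 < ·)) (T := {11, 13, 17, 19, 23, 29, 31, 37}) (B := 41)
          (fun q hq => by simp only [Finset.mem_insert, Finset.mem_singleton] at hq; omega)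
          (fun q hq hq41 => by
            obtain ⟨hqQ, hq7⟩ := Finset.mem_filter.1 hq
            have h := mem_of_prime_lt_41' (hQ q hqQ).1 (by omega) hq41
            simp only [Finset.mem_insert, Finset.mem_singleton] at h ⊢
            omega)
          (by rw [show ({11, 13, 17, 19, 23, 29, 31, 37} : Finset ℕ).card = 8 by simp]; omega)
        rw [prod_primes_11_to_37', show ({11, 13, 17, 19, 23, 29, 31, 37} : Finset ℕ).card = 8 by simp] at hlayer
        have hA : 35336848261 * 41 ^ (t - 8) < 7 ^ d := lt_of_le_of_lt (hlayer.trans hprodU) hlt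
        have hA2 : (35336848261 * 41 ^ (t - 8)) ^ 2 < (7 ^ d) ^ 2 := Nat.pow_lt_pow_left hA two_ne_zero
        have hpow : 7 ^ (24 + 3 * (t - 8)) ≤ (35336848261 * 41 ^ (t - 8)) ^ 2 := by
          rw [mul_pow, ← pow_mul, pow_add, pow_mul 7 3 (t - 8), mul_comm (t - 8) 2, pow_mul 41 2 (t - 8)]
          exact Nat.mul_le_mul (by norm_num) (Nat.pow_le_pow_left (by norm_num) _)
        have h2d : 24 + 3 * (t - 8) < d * 2 := by
          have := lt_of_le_of_lt hpow hA2
          rw [← pow_mul] at this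
          exact (Nat.pow_lt_pow_iff_right (by norm_num : 1 < 7)).1 this
        omega
      · -- Table 1: `d ≥ 11`
        have hd11 : 11 ≤ d := by
          by_contra hlt'
          have := card_le_four_of_forall_dvd_pow_sub_one' (Or.inl ⟨rfl, by omega⟩) hd hQ
          omega
        omega
    · -- `ℓ = 11`: at most two elements (`5, 7`) lie below `11`, so `d ≥ t + 1 ≥ #Q − 1`; and `d ≥ 5` by Table 1
      have hs2 : s ≤ 2 := by
        have : (Q.filter fun q => ¬11 < q) ⊆ {5, 7} := fun q hq => by
          obtain ⟨hqp, hq5, hq11⟩ := hmemL q hq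
          rw [Finset.mem_insert, Finset.mem_singleton]
          interval_cases q
          · exact Or.inl rfl
          · exact absurd hqp (by decide)
          · exact Or.inr rfl
          · exact absurd hqp (by decide)
          · exact absurd hqp (by decide)
          · exact absurd hqp (by decide)
        exact (Finset.card_le_card this).trans (by simp)
      have hd5 : 5 ≤ d := by
        by_contra hlt'
        have := card_le_four_of_forall_dvd_pow_sub_one' (Or.inr ⟨rfl, by omega⟩) hd hQ
        omega
      omega

end PerPrime

/-! ## §4 The weighted criterion with `20ω(N) < 3(ℓ − 1)d`; Remark 1 at levels with at least six prime factors -/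

section SixLe

variable {N : ℕ}

/-- **`40·Σ T_ℓ < 3·φ(N)` from the weighted criterion** when `20ω(N) < 3(ℓ − 1)·d` for every prime `ℓ ∣ N` and `d ≥ 1` with `N_ℓ ∣ ℓᵈ − 1`
(the sibling's `forty_mul_sum_card_lt_of_forall_le` with `c = ⌊20ω(N)/3⌋ + 1`). [cite: KoblitzRohrlich1978, §2 proof of the Proposition
(pp. 1190–1192) and Remark 1 (p. 1192)] -/
theorem forty_mul_sum_card_lt_of_forall_lt (hN : N ≠ 0)
    (h : ∀ ℓ ∈ N.primeFactors, ∀ d : ℕ, 0 < d → ordCompl[ℓ] N ∣ ℓ ^ d - 1 → 20 * N.primeFactors.card < 3 * ((ℓ - 1) * d)) :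
    40 * ∑ ℓ ∈ N.primeFactors,
        Nat.card {ψ : DirichletCharacter ℂ (ordCompl[ℓ] N) // ψ.Odd ∧ ψ (ℓ : ZMod (ordCompl[ℓ] N)) = 1} < 3 * N.totient :=
  forty_mul_sum_card_lt_of_forall_le hN (c := 20 * N.primeFactors.card / 3 + 1) (by omega) fun ℓ hℓ d hd hdvd => by
    have := h ℓ hℓ d hd hdvd
    omega

/-- The weighted criterion's hypothesis at levels with at least six prime factors `≥ 5` (§3 applied to the other prime factors of `N`).
[cite: KoblitzRohrlich1978, §2 Proposition, Cases 4–5 (pp. 1191–1192)] -/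
private theorem criterion_six_le (h6 : 6 ≤ N.primeFactors.card) (h5 : ∀ ℓ ∈ N.primeFactors, 5 ≤ ℓ) :
    ∀ ℓ ∈ N.primeFactors, ∀ d : ℕ, 0 < d → ordCompl[ℓ] N ∣ ℓ ^ d - 1 → 20 * N.primeFactors.card < 3 * ((ℓ - 1) * d) := by
  classical
  intro ℓ hℓ d hd hdvd
  have hℓp : ℓ.Prime := Nat.prime_of_mem_primeFactors hℓ
  have mem : ∀ q ∈ N.primeFactors.erase ℓ, q.Prime ∧ 5 ≤ q ∧ q ∣ ℓ ^ d - 1 := by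
    intro q hq
    obtain ⟨hqℓ, hqN⟩ := Finset.mem_erase.1 hq
    have hqp : q.Prime := Nat.prime_of_mem_primeFactors hqN
    refine ⟨hqp, h5 q hqN, dvd_trans (Nat.dvd_ordCompl_of_dvd_not_dvd (Nat.dvd_of_mem_primeFactors hqN) ?_) hdvd⟩
    intro h
    exact hqℓ ((Nat.prime_dvd_prime_iff_eq hℓp hqp).1 h).symm
  have hc : (N.primeFactors.erase ℓ).card + 1 = N.primeFactors.card := Finset.card_erase_add_one hℓ
  rw [← hc]
  exact twenty_mul_card_succ_lt_of_five_le_card hℓp (h5 ℓ hℓ) hd mem (by omega)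

/-- **REMARK 1 AT LEVELS WITH AT LEAST SIX PRIME FACTORS**: if `N` has at least six prime factors, all `≥ 5`, then `40·#S₀(N) < 3·φ(N)`
(`s(N) < 3/20`; K–R's Cases 4–5 with the constant `3/20` in place of `1/6`). [cite: KoblitzRohrlich1978, §2 Remark 1 (p. 1192) and
Proposition, Cases 4–5 (pp. 1191–1192)] -/
theorem forty_mul_card_bad_lt_of_six_le_card_primeFactors [NeZero N] (h6 : 6 ≤ N.primeFactors.card)
    (h5 : ∀ ℓ ∈ N.primeFactors, 5 ≤ ℓ) :
    40 * Nat.card {χ : DirichletCharacter ℂ N // χ.Odd ∧ bernoulliOneChar χ = 0} < 3 * N.totient :=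
  lt_of_le_of_lt (Nat.mul_le_mul_left _ card_odd_bernoulliOneChar_eq_zero_le)
    (forty_mul_sum_card_lt_of_forall_lt (NeZero.ne N) (criterion_six_le h6 h5))

/-- A level with a prime factor, all prime factors `≥ 5`, exceeds `2` (private copy). [folklore] -/
private theorem two_lt_of_primeFactors' [NeZero N] (hne : N.primeFactors.Nonempty) (h5 : ∀ ℓ ∈ N.primeFactors, 5 ≤ ℓ) : 2 < N := by
  obtain ⟨ℓ, hℓ⟩ := hne
  have hle : ℓ ≤ N := Nat.le_of_dvd (NeZero.pos N) (Nat.dvd_of_mem_primeFactors hℓ)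
  have := h5 ℓ hℓ
  omega

/-- From `40·#S₀(N) < 3·φ(N)` to `s(N) < 3/20` in `ℚ` (`#S(N) = φ(N)/2`; private copy). [cite: KoblitzRohrlich1978, §2 Remark 1 (p. 1192)] -/
private theorem s_lt_of_forty_mul_lt' [NeZero N] (hN2 : 2 < N)
    (h : 40 * Nat.card {χ : DirichletCharacter ℂ N // χ.Odd ∧ bernoulliOneChar χ = 0} < 3 * N.totient) :
    (Nat.card {χ : DirichletCharacter ℂ N // χ.Odd ∧ bernoulliOneChar χ = 0} : ℚ) /
        Nat.card {χ : DirichletCharacter ℂ N // χ.Odd} < 3 / 20 := by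
  have hS := two_mul_card_odd_eq_totient' (M := N) hN2
  have hSpos : 0 < Nat.card {χ : DirichletCharacter ℂ N // χ.Odd} := by
    have := Nat.totient_pos.2 (NeZero.pos N)
    omega
  rw [div_lt_div_iff₀ (by exact_mod_cast hSpos) (by norm_num)]
  have h' : (40 : ℚ) * Nat.card {χ : DirichletCharacter ℂ N // χ.Odd ∧ bernoulliOneChar χ = 0} <
      3 * (2 * Nat.card {χ : DirichletCharacter ℂ N // χ.Odd}) := by
    rw [show (3 : ℚ) * (2 * Nat.card {χ : DirichletCharacter ℂ N // χ.Odd}) = 3 * ((2 * Nat.card {χ : DirichletCharacter ℂ N // χ.Odd} : ℕ) : ℚ)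
      by push_cast; ring, hS]
    exact_mod_cast h
  linarith

/-- From `40·#S₀(N) ≤ 3·φ(N)` to `s(N) ≤ 3/20` in `ℚ`. [cite: KoblitzRohrlich1978, §2 Remark 1 (p. 1192)] -/
private theorem s_le_of_forty_mul_le [NeZero N] (hN2 : 2 < N)
    (h : 40 * Nat.card {χ : DirichletCharacter ℂ N // χ.Odd ∧ bernoulliOneChar χ = 0} ≤ 3 * N.totient) :
    (Nat.card {χ : DirichletCharacter ℂ N // χ.Odd ∧ bernoulliOneChar χ = 0} : ℚ) /
        Nat.card {χ : DirichletCharacter ℂ N // χ.Odd} ≤ 3 / 20 := by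
  have hS := two_mul_card_odd_eq_totient' (M := N) hN2
  have hSpos : 0 < Nat.card {χ : DirichletCharacter ℂ N // χ.Odd} := by
    have := Nat.totient_pos.2 (NeZero.pos N)
    omega
  rw [div_le_div_iff₀ (by exact_mod_cast hSpos) (by norm_num)]
  have h' : (40 : ℚ) * Nat.card {χ : DirichletCharacter ℂ N // χ.Odd ∧ bernoulliOneChar χ = 0} ≤
      3 * (2 * Nat.card {χ : DirichletCharacter ℂ N // χ.Odd}) := by
    rw [show (3 : ℚ) * (2 * Nat.card {χ : DirichletCharacter ℂ N // χ.Odd}) = 3 * ((2 * Nat.card {χ : DirichletCharacter ℂ N // χ.Odd} : ℕ) : ℚ)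
      by push_cast; ring, hS]
    exact_mod_cast h
  linarith

/-- **`s(N) < 3/20` at levels with at least six prime factors** (all `≥ 5`). [cite: KoblitzRohrlich1978, §2 Remark 1 (p. 1192)] -/
theorem s_lt_three_div_twenty_of_six_le_card_primeFactors [NeZero N] (h6 : 6 ≤ N.primeFactors.card)
    (h5 : ∀ ℓ ∈ N.primeFactors, 5 ≤ ℓ) :
    (Nat.card {χ : DirichletCharacter ℂ N // χ.Odd ∧ bernoulliOneChar χ = 0} : ℚ) /
        Nat.card {χ : DirichletCharacter ℂ N // χ.Odd} < 3 / 20 :=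
  s_lt_of_forty_mul_lt' (two_lt_of_primeFactors' (by rw [← Finset.card_pos]; omega) h5)
    (forty_mul_card_bad_lt_of_six_le_card_primeFactors h6 h5)

end SixLe

/-! ## §5 REMARK 1 AT EVERY LEVEL `N > 1` PRIME TO `6`: `s(N) ≤ 3/20`, with equality iff `N = 55` -/

section EveryLevel

variable {N : ℕ}

/-- **`40·#S₀(N) < 3·φ(N)` at every level `N > 1` prime to `6` other than `55`** (prime powers: `S₀ = ∅`; `ω(N) = 2`: the sibling's
`forty_mul_card_bad_lt_twoPrimes`; `ω(N) = 3, 4, 5`: the siblings; `ω(N) ≥ 6`: §4). [cite: KoblitzRohrlich1978, §2 Remark 1 (p. 1192) and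
Proposition, Cases 1–5 (pp. 1190–1192)] -/
theorem forty_mul_card_bad_lt_of_ne_fiftyFive [NeZero N] (hN1 : 1 < N) (h5 : ∀ ℓ ∈ N.primeFactors, 5 ≤ ℓ) (h55 : N ≠ 55) :
    40 * Nat.card {χ : DirichletCharacter ℂ N // χ.Odd ∧ bernoulliOneChar χ = 0} < 3 * N.totient := by
  classical
  have hN0 : N ≠ 0 := by omega
  -- `N = ∏_{p ∣ N} p^{v_p(N)}`
  have hNfac : ∏ p ∈ N.primeFactors, p ^ N.factorization p = N := (Nat.prod_primeFactors_pow_factorization hN0).symm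
  have hexp : ∀ p ∈ N.primeFactors, N.factorization p ≠ 0 := fun p hp =>
    Finsupp.mem_support_iff.1 (by rwa [Nat.support_factorization])
  have hm : N.primeFactors.card = 0 ∨ N.primeFactors.card = 1 ∨ N.primeFactors.card = 2 ∨ N.primeFactors.card = 3 ∨
      N.primeFactors.card = 4 ∨ N.primeFactors.card = 5 ∨ 6 ≤ N.primeFactors.card := by omega
  rcases hm with h | h | h | h | h | h | h
  · -- no prime factor: `N ≤ 1`
    rw [Finset.card_eq_zero, Nat.primeFactors_eq_empty] at h
    omega
  · -- prime power: `#S₀ = 0`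
    obtain ⟨p, hs⟩ := Finset.card_eq_one.1 h
    have hp : p ∈ N.primeFactors := by rw [hs]; exact Finset.mem_singleton_self p
    haveI := Fact.mk (Nat.prime_of_mem_primeFactors hp)
    obtain ⟨a, ha⟩ : ∃ a, N.factorization p = a := ⟨_, rfl⟩
    have hφ : 0 < N.totient := Nat.totient_pos.2 (NeZero.pos N)
    rw [hs, Finset.prod_singleton, ha] at hNfac
    subst hNfac
    rw [card_bad_primePow_eq_zero, mul_zero]
    omega
  · -- two primes
    obtain ⟨p, q, hpq, hs⟩ := Finset.card_eq_two.1 h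
    have hp : p ∈ N.primeFactors := by rw [hs]; simp
    have hq : q ∈ N.primeFactors := by rw [hs]; simp
    haveI := Fact.mk (Nat.prime_of_mem_primeFactors hp)
    haveI := Fact.mk (Nat.prime_of_mem_primeFactors hq)
    rw [hs, Finset.prod_pair hpq] at hNfac
    exact forty_mul_card_bad_lt_twoPrimes (h5 p hp) (h5 q hq) hpq (hexp p hp) (hexp q hq) hNfac.symm h55
  · -- three primes
    obtain ⟨p, q, r, hpq, hpr, hqr, hs⟩ := Finset.card_eq_three.1 h
    have hp : p ∈ N.primeFactors := by rw [hs]; simp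
    have hq : q ∈ N.primeFactors := by rw [hs]; simp
    have hr : r ∈ N.primeFactors := by rw [hs]; simp
    have hnot : p ∉ ({q, r} : Finset ℕ) := by simp [hpq, hpr]
    rw [hs, Finset.prod_insert hnot, Finset.prod_pair hqr, ← mul_assoc] at hNfac
    exact forty_mul_card_bad_lt_three_primes (Nat.prime_of_mem_primeFactors hp) (Nat.prime_of_mem_primeFactors hq)
      (Nat.prime_of_mem_primeFactors hr) (h5 p hp) (h5 q hq) (h5 r hr) hpq hpr hqr (hexp p hp) (hexp q hq) (hexp r hr) hNfac.symm
  · exact forty_mul_card_bad_lt_four_primes h h5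
  · exact forty_mul_card_bad_lt_five_primes h h5
  · exact forty_mul_card_bad_lt_of_six_le_card_primeFactors h h5

/-- **REMARK 1 "`3/20` is the maximum for `s(N)`", integer form, EVERY LEVEL**: for `N > 1` with all prime factors `≥ 5`,
`40·#S₀(N) ≤ 3·φ(N)` (`#S(N) = φ(N)/2`, so `#S₀(N)/#S(N) ≤ 3/20`). [cite: KoblitzRohrlich1978, §2 Remark 1 (p. 1192)] -/
theorem forty_mul_card_bad_le_of_five_le_primeFactors [NeZero N] (hN1 : 1 < N) (h5 : ∀ ℓ ∈ N.primeFactors, 5 ≤ ℓ) :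
    40 * Nat.card {χ : DirichletCharacter ℂ N // χ.Odd ∧ bernoulliOneChar χ = 0} ≤ 3 * N.totient := by
  by_cases h55 : N = 55
  · subst h55
    exact forty_mul_card_bad_fiftyFive_eq.le
  · exact (forty_mul_card_bad_lt_of_ne_fiftyFive hN1 h5 h55).le

/-- **"attained only when `N = 55`", EVERY LEVEL**: for `N > 1` with all prime factors `≥ 5`, `40·#S₀(N) < 3·φ(N)` iff `N ≠ 55`.
[cite: KoblitzRohrlich1978, §2 Remark 1 (p. 1192)] -/
theorem forty_mul_card_bad_lt_iff_ne_fiftyFive [NeZero N] (hN1 : 1 < N) (h5 : ∀ ℓ ∈ N.primeFactors, 5 ≤ ℓ) :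
    40 * Nat.card {χ : DirichletCharacter ℂ N // χ.Odd ∧ bernoulliOneChar χ = 0} < 3 * N.totient ↔ N ≠ 55 := by
  constructor
  · rintro h rfl
    rw [forty_mul_card_bad_fiftyFive_eq] at h
    exact lt_irrefl _ h
  · exact forty_mul_card_bad_lt_of_ne_fiftyFive hN1 h5

/-- **The printed normalisation `#S₀(N) ≤ (3/20)·#S(N)`, EVERY LEVEL**: for `N > 1` with all prime factors `≥ 5`, `20·#S₀(N) ≤ 3·#S(N)`, where
`#S(N)` is the number of odd characters mod `N` (`= φ(N)/2`). [cite: KoblitzRohrlich1978, §2 Remark 1 (p. 1192)] -/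
theorem twenty_mul_card_bad_le_three_mul_card_odd [NeZero N] (hN1 : 1 < N) (h5 : ∀ ℓ ∈ N.primeFactors, 5 ≤ ℓ) :
    20 * Nat.card {χ : DirichletCharacter ℂ N // χ.Odd ∧ bernoulliOneChar χ = 0} ≤ 3 * Nat.card {χ : DirichletCharacter ℂ N // χ.Odd} := by
  have hN2 : 2 < N :=
    two_lt_of_primeFactors' (Nat.nonempty_primeFactors.2 hN1) h5
  have hS := two_mul_card_odd_eq_totient' (M := N) hN2
  have h := forty_mul_card_bad_le_of_five_le_primeFactors hN1 h5
  omega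

/-- **`20·#S₀(N) < 3·#S(N)` iff `N ≠ 55`**, EVERY LEVEL `N > 1` prime to `6`. [cite: KoblitzRohrlich1978, §2 Remark 1 (p. 1192)] -/
theorem twenty_mul_card_bad_lt_three_mul_card_odd_iff [NeZero N] (hN1 : 1 < N) (h5 : ∀ ℓ ∈ N.primeFactors, 5 ≤ ℓ) :
    20 * Nat.card {χ : DirichletCharacter ℂ N // χ.Odd ∧ bernoulliOneChar χ = 0} < 3 * Nat.card {χ : DirichletCharacter ℂ N // χ.Odd} ↔
      N ≠ 55 := by
  have hN2 : 2 < N :=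
    two_lt_of_primeFactors' (Nat.nonempty_primeFactors.2 hN1) h5
  have hS := two_mul_card_odd_eq_totient' (M := N) hN2
  rw [← forty_mul_card_bad_lt_iff_ne_fiftyFive hN1 h5]
  constructor <;> intro h <;> omega

/-- **REMARK 1, "`3/20` is the maximum for `s(N)`", EVERY LEVEL**: for `N > 1` with all prime factors `≥ 5`, `s(N) = #S₀(N)/#S(N) ≤ 3/20`.
[cite: KoblitzRohrlich1978, §2 Remark 1 (p. 1192)] -/
theorem s_le_three_div_twenty [NeZero N] (hN1 : 1 < N) (h5 : ∀ ℓ ∈ N.primeFactors, 5 ≤ ℓ) :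
    (Nat.card {χ : DirichletCharacter ℂ N // χ.Odd ∧ bernoulliOneChar χ = 0} : ℚ) /
        Nat.card {χ : DirichletCharacter ℂ N // χ.Odd} ≤ 3 / 20 :=
  s_le_of_forty_mul_le (two_lt_of_primeFactors' (Nat.nonempty_primeFactors.2 hN1) h5)
    (forty_mul_card_bad_le_of_five_le_primeFactors hN1 h5)

/-- **`s(N) < 3/20` iff `N ≠ 55`**, EVERY LEVEL `N > 1` prime to `6`. [cite: KoblitzRohrlich1978, §2 Remark 1 (p. 1192)] -/
theorem s_lt_three_div_twenty_iff [NeZero N] (hN1 : 1 < N) (h5 : ∀ ℓ ∈ N.primeFactors, 5 ≤ ℓ) :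
    (Nat.card {χ : DirichletCharacter ℂ N // χ.Odd ∧ bernoulliOneChar χ = 0} : ℚ) /
        Nat.card {χ : DirichletCharacter ℂ N // χ.Odd} < 3 / 20 ↔ N ≠ 55 := by
  constructor
  · rintro h rfl
    rw [s_fiftyFive] at h
    exact lt_irrefl _ h
  · intro h55
    exact s_lt_of_forty_mul_lt' (two_lt_of_primeFactors' (Nat.nonempty_primeFactors.2 hN1) h5)
      (forty_mul_card_bad_lt_of_ne_fiftyFive hN1 h5 h55)

/-- **"attained only when `N = 55`"**: for `N > 1` with all prime factors `≥ 5`, `s(N) = 3/20` iff `N = 55`.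
[cite: KoblitzRohrlich1978, §2 Remark 1 (p. 1192)] -/
theorem s_eq_three_div_twenty_iff [NeZero N] (hN1 : 1 < N) (h5 : ∀ ℓ ∈ N.primeFactors, 5 ≤ ℓ) :
    (Nat.card {χ : DirichletCharacter ℂ N // χ.Odd ∧ bernoulliOneChar χ = 0} : ℚ) /
        Nat.card {χ : DirichletCharacter ℂ N // χ.Odd} = 3 / 20 ↔ N = 55 := by
  have hlt := s_lt_three_div_twenty_iff hN1 h5
  constructor
  · intro h
    by_contra h55
    exact absurd h (hlt.2 h55).ne
  · rintro rfl
    exact s_fiftyFive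

/-- **`s(N) ≤ s(55)` at EVERY level `N > 1` prime to `6`** — Koblitz–Rohrlich's Remark 1 "`3/20` is the maximum for `s(N)`" as printed: the
ratio `#S₀(N)/#S(N)` never exceeds its value at `N = 55`. [cite: KoblitzRohrlich1978, §2 Remark 1 (p. 1192)] -/
theorem s_le_s_fiftyFive [NeZero N] (hN1 : 1 < N) (h5 : ∀ ℓ ∈ N.primeFactors, 5 ≤ ℓ) :
    (Nat.card {χ : DirichletCharacter ℂ N // χ.Odd ∧ bernoulliOneChar χ = 0} : ℚ) /
        Nat.card {χ : DirichletCharacter ℂ N // χ.Odd} ≤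
      (Nat.card {χ : DirichletCharacter ℂ 55 // χ.Odd ∧ bernoulliOneChar χ = 0} : ℚ) /
        Nat.card {χ : DirichletCharacter ℂ 55 // χ.Odd} := by
  rw [s_fiftyFive]
  exact s_le_three_div_twenty hN1 h5

/-- **`s(N) < s(55)` unless `N = 55`**, EVERY LEVEL `N > 1` prime to `6`. [cite: KoblitzRohrlich1978, §2 Remark 1 (p. 1192)] -/
theorem s_lt_s_fiftyFive_of_ne [NeZero N] (hN1 : 1 < N) (h5 : ∀ ℓ ∈ N.primeFactors, 5 ≤ ℓ) (h55 : N ≠ 55) :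
    (Nat.card {χ : DirichletCharacter ℂ N // χ.Odd ∧ bernoulliOneChar χ = 0} : ℚ) /
        Nat.card {χ : DirichletCharacter ℂ N // χ.Odd} <
      (Nat.card {χ : DirichletCharacter ℂ 55 // χ.Odd ∧ bernoulliOneChar χ = 0} : ℚ) /
        Nat.card {χ : DirichletCharacter ℂ 55 // χ.Odd} := by
  rw [s_fiftyFive]
  exact (s_lt_three_div_twenty_iff hN1 h5).2 h55

end EveryLevel

end CyclotomicFermatCMType

end Literature.AlgebraicGeometry.ComplexMultiplication
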